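import Literature.Probability.LatticeModels.MeshCells
import Literature.Topology.PlaneTopology.ArgumentIncrement
import HarnessLib

/-!
# Small loops through a mesh column: access paths, the vertical spine, and their crossing defects

Topic: Probability / LatticeModels (third file of the "bulk = largest mesh component for every
Jordan domain" theorem, `MeshDomainJordan.lean`; sub-namespace `…LatticeModels.Mesh`). For an open
`Ω ⊆ ℂ` with `∂Ω ⊆ closure (Ω̄)ᶜ` and a mesh `δ > 0` this file builds the pieces of the short
loops `σ` that cross a run of perfect cells of one column and close up through the exterior:

* `AvoidsMesh Ω δ z` — `z` is not the mesh point of a mesh vertex and lies on no closed mesh edge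
  between mesh vertices; points of open cells, mesh points of non-vertices (lattice points of
  `∂Ω`), and exterior points all avoid the mesh (`avoidsMesh_of_mem_cell`, `…_of_not_mem`,
  `…_of_mem_exterior`).
* **Access paths** (`exists_accessPath`): from the centre of a cell that is *not perfect* there is
  a path to an exterior point, of length `< 3δ`, all of whose points avoid the mesh (straight to an
  exterior point of the cell if it is not full; else through a corner lying on `∂Ω` into an
  adjacent open cell containing an exterior point).
* **The spine** `spine δ k jb n`: the vertical polygonal path along `re z = δ(k + ½)` from the
  centre of cell `(k, jb)` to the centre of cell `(k, jb + n)`, the concatenation of `n` unit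
  segments; its points have `re z = δ(k + ½)` and `im z ∈ [δ(jb + ½), δ(jb + n + ½)]`, and its
  crossing defect relative to the rung at height `δ j'`, `jb < j' ≤ jb + n`, is `2πi` (one
  transversal crossing, `crossInc_spine_rung`), relative to any segment it misses it is `0`.
* `wind_eq_zero_of_subset_ball`: a loop inside `ball c R` has winding number `0` about every point
  at distance `≥ R` from `c` (Rouché for logarithms against the constant `c - z`).

Folklore. Mathlib anchors: `Path.segment`, `Path.trans`, `Path.symm`, `Metric.ball`. H21 anchors:
`Path.crossInc`, `crossInc_trans`, `crossInc_eq_zero`, `crossInc_segment_of_cross`, `segSide`,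
`wind`, `hasLogOn_of_norm_sub_lt`, `wind_comp_eq_zero_of_hasLogOn` (`ArgumentIncrement.lean`,
`WindingNumber.lean`); `Mesh.cell`, `Mesh.corner`, `Mesh.IsPerfect`, … (`MeshColumns.lean`,
`MeshCells.lean`).
-/

namespace Literature.Probability.LatticeModels.Mesh

open Set Complex Metric Literature.Topology.PlaneTopology

noncomputable section

variable {Ω : Set ℂ} {δ : ℝ}

/-! ### Points avoiding the mesh -/

/-- `z` *avoids the mesh* of `Ω` at scale `δ`: it is not the mesh point of a mesh vertex, and it
lies on no closed mesh edge joining two mesh vertices. The trace of any walk in the mesh graph on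
mesh vertices misses such points. [folklore] -/
def AvoidsMesh (Ω : Set ℂ) (δ : ℝ) (z : ℂ) : Prop :=
  (∀ v ∈ meshVertices Ω δ, z ≠ meshPoint δ v) ∧
    ∀ a ∈ meshVertices Ω δ, ∀ b ∈ meshVertices Ω δ, (meshGraph Ω δ).Adj a b →
      z ∉ segment ℝ (meshPoint δ a) (meshPoint δ b)

/-- Points off the grid lines avoid the mesh. [folklore] -/
theorem avoidsMesh_of_not_mem_gridLines {z : ℂ} (hz : z ∉ gridLines δ) : AvoidsMesh Ω δ z := by
  refine ⟨fun v _ h => hz (h ▸ meshPoint_mem_gridLines δ v), fun a _ b _ hab h => hz ?_⟩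
  exact segment_meshPoint_subset_gridLines δ (meshGraph_adj_iff.1 hab).1 h

/-- Points of open cells avoid the mesh (`δ > 0`). [folklore] -/
theorem avoidsMesh_of_mem_cell (hδ : 0 < δ) {k j : ℤ} {z : ℂ} (hz : z ∈ cell δ k j) :
    AvoidsMesh Ω δ z :=
  avoidsMesh_of_not_mem_gridLines (cell_subset_compl_gridLines hδ k j hz)

/-- Mesh points are determined by their site (`δ ≠ 0`). [folklore] -/
theorem meshPoint_injective (hδ : δ ≠ 0) : Function.Injective (meshPoint δ) := fun x y h => by
  rw [← nearestSite_meshPoint hδ x, h, nearestSite_meshPoint hδ y]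

/-- The mesh point of a site that is *not* a mesh vertex avoids the mesh (`δ > 0`): it differs from
the mesh points of vertices, and a mesh point on a closed mesh edge is one of its two ends.
[folklore] -/
theorem avoidsMesh_meshPoint_of_not_mem (hδ : 0 < δ) {v : Site 2} (hv : v ∉ meshVertices Ω δ) :
    AvoidsMesh Ω δ (meshPoint δ v) := by
  refine ⟨fun w hw h => hv ?_, fun a ha b hb hab h => ?_⟩
  · rwa [meshPoint_injective hδ.ne' h]
  · rcases eq_or_eq_of_meshPoint_mem_segment hδ (meshGraph_adj_iff.1 hab).1 h with rfl | rfl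
    · exact hv ha
    · exact hv hb

/-- Exterior points avoid the mesh: mesh vertices lie in `Ω` and closed mesh edges in `Ω̄`.
[folklore] -/
theorem avoidsMesh_of_mem_exterior {z : ℂ} (hz : z ∈ (closure Ω)ᶜ) : AvoidsMesh Ω δ z := by
  refine ⟨fun v hv h => hz ?_, fun a _ b _ hab h => hz ((meshGraph_adj_iff.1 hab).2 h)⟩
  rw [h]
  exact subset_closure hv

/-! ### Access paths from a non-perfect cell to the exterior -/

/-- A point of a closed segment is an end-point or a point of the open segment. [folklore] -/
theorem eq_or_eq_or_mem_openSegment {x y z : ℂ} (h : z ∈ segment ℝ x y) :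
    z = x ∨ z = y ∨ z ∈ openSegment ℝ x y := by
  rw [← insert_endpoints_openSegment] at h
  rcases h with h | h | h
  · exact Or.inl h
  · exact Or.inr (Or.inl h)
  · exact Or.inr (Or.inr h)

/-- Two points of one cell are at distance `< 2δ`. [folklore] -/
theorem dist_lt_of_mem_cell {k j : ℤ} {z w : ℂ} (hz : z ∈ cell δ k j) (hw : w ∈ cell δ k j) :
    dist z w < 2 * δ := by
  obtain ⟨⟨h1, h2⟩, h3, h4⟩ := hz
  obtain ⟨⟨h5, h6⟩, h7, h8⟩ := hw
  rw [Complex.dist_eq]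
  refine (norm_le_abs_re_add_abs_im _).trans_lt ?_
  rw [sub_re, sub_im]
  have hre : |z.re - w.re| < δ := by rw [abs_lt]; constructor <;> linarith
  have him : |z.im - w.im| < δ := by rw [abs_lt]; constructor <;> linarith
  linarith

/-- **Access path.** If the cell `(k, j)` is not perfect (for open `Ω` with `∂Ω ⊆ closure (Ω̄)ᶜ`,
`δ > 0`), there is an exterior point `x` and a path from the centre of the cell to `x`, all of
whose points avoid the mesh and lie within `4δ` of the centre. (If the cell is not full: the
segment to an exterior point of the cell. If it is full: the segment to a corner `κ ∈ ∂Ω`, then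
the segment from `κ` to an exterior point of an open cell at `κ`; open segments from a corner into
an open cell stay in the cell.) [folklore] -/
theorem exists_accessPath (hΩo : IsOpen Ω) (hJE : frontier Ω ⊆ closure (closure Ω)ᶜ) (hδ : 0 < δ)
    {k j : ℤ} (h : ¬ IsPerfect Ω δ k j) :
    ∃ x ∈ (closure Ω)ᶜ, ∃ γ : Path (cellCenter δ k j) x,
      (∀ t, AvoidsMesh Ω δ (γ t)) ∧ ∀ t, dist (γ t) (cellCenter δ k j) < 4 * δ := by
  have hc := cellCenter_mem_cell hδ k j
  by_cases hf : IsFull Ω δ k j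
  · -- full but not perfect: through a boundary corner `κ = meshPoint δ v`
    obtain ⟨a, b, hκ⟩ := exists_corner_mem_frontier hΩo hδ hf h
    obtain ⟨k', j', x, hk', hj', hxcell, hxE, hxd⟩ := exists_exterior_cell_near hδ (hJE hκ)
    obtain ⟨a', b', hab'⟩ := exists_corner_eq_of_offset hk' hj'
    have hvΩ : corner k j a b ∉ meshVertices Ω δ := by
      intro hvΩ
      rw [hΩo.frontier_eq] at hκ
      exact hκ.2 hvΩ
    set κ := meshPoint δ (corner k j a b) with hκdef
    set γ : Path (cellCenter δ k j) x :=
      (Path.segment (cellCenter δ k j) κ).trans (Path.segment κ x) with hγ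
    -- the range of `γ` lies in `cell ∪ {κ} ∪ cell'`
    have hrange : ∀ t, γ t ∈ cell δ k j ∨ γ t = κ ∨ γ t ∈ cell δ k' j' := by
      intro t
      have hmem : γ t ∈ segment ℝ (cellCenter δ k j) κ ∪ segment ℝ κ x := by
        have := mem_range_self (f := γ) t
        rwa [hγ, Path.trans_range, Path.range_segment, Path.range_segment] at this
      rcases hmem with hm | hm
      · rcases eq_or_eq_or_mem_openSegment hm with h1 | h1 | h1
        · left; rw [h1]; exact hc
        · exact Or.inr (Or.inl h1)
        · exact Or.inl (openSegment_subset_cell_of_mem_closure k j hc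
            (meshPoint_corner_mem_closure_cell hδ k j a b) h1)
      · rcases eq_or_eq_or_mem_openSegment hm with h1 | h1 | h1
        · exact Or.inr (Or.inl h1)
        · right; right; rw [h1]; exact hxcell
        · refine Or.inr (Or.inr (openSegment_corner_subset_cell hδ k' j' a' b' hxcell ?_))
          rwa [hab']
    have hκc : dist κ (cellCenter δ k j) < 2 * δ := by
      rw [dist_comm]; exact dist_corner_lt_of_mem_cell hδ hc a b
    refine ⟨x, hxE, γ, fun t => ?_, fun t => ?_⟩
    · rcases hrange t with h1 | h1 | h1
      · exact avoidsMesh_of_mem_cell hδ h1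
      · rw [h1]; exact avoidsMesh_meshPoint_of_not_mem hδ hvΩ
      · exact avoidsMesh_of_mem_cell hδ h1
    · rcases hrange t with h1 | h1 | h1
      · linarith [dist_lt_of_mem_cell h1 hc]
      · rw [h1]; linarith
      · have h2 : dist (γ t) κ < 2 * δ := by
          have := dist_corner_lt_of_mem_cell hδ h1 a' b'
          rwa [hab'] at this
        linarith [dist_triangle (γ t) κ (cellCenter δ k j)]
  · -- not full: straight to an exterior point of the cell
    obtain ⟨x, hxcell, hxE⟩ := exists_mem_cell_exterior_of_not_isFull hΩo hJE hf
    have hsub : ∀ t, Path.segment (cellCenter δ k j) x t ∈ cell δ k j := fun t => by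
      have hmem : Path.segment (cellCenter δ k j) x t ∈ segment ℝ (cellCenter δ k j) x := by
        rw [← Path.range_segment]; exact mem_range_self t
      exact (convex_cell δ k j).segment_subset hc hxcell hmem
    refine ⟨x, hxE, Path.segment (cellCenter δ k j) x, fun t => avoidsMesh_of_mem_cell hδ (hsub t),
      fun t => ?_⟩
    linarith [dist_lt_of_mem_cell (hsub t) hc]

/-! ### The vertical spine of a column and its crossing defect relative to a rung -/

/-- The side functional of a *horizontal* segment `[ℓ, r]` (`im ℓ = im r`):
`segSide ℓ r z = (im z - im ℓ) (re ℓ - re r)`. [folklore] -/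
theorem segSide_of_im_eq {ℓ r : ℂ} (h : ℓ.im = r.im) (z : ℂ) :
    segSide ℓ r z = (z.im - ℓ.im) * (ℓ.re - r.re) := by
  unfold segSide
  rw [Complex.mul_im, Complex.conj_re, Complex.conj_im, sub_re, sub_im, sub_re, sub_im, h]
  ring

/-- The two ends of the rung `j'` of column `k`: mesh points `δ(k, j')` and `δ(k+1, j')`.
[folklore] -/
theorem meshPoint_rung_left (δ : ℝ) (k j' : ℤ) :
    meshPoint δ (corner k j' false false) = ⟨δ * k, δ * j'⟩ := by
  apply Complex.ext <;> simp [corner]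

/-- The two ends of the rung `j'` of column `k`: mesh points `δ(k, j')` and `δ(k+1, j')`.
[folklore] -/
theorem meshPoint_rung_right (δ : ℝ) (k j' : ℤ) :
    meshPoint δ (corner k j' true false) = ⟨δ * (k + 1), δ * j'⟩ := by
  apply Complex.ext <;> simp [corner]

/-- The midpoint of the rung `j'` of column `k` lies on the open rung and on the vertical segment
between the centres of the cells `(k, jb)` and `(k, jt)` when `jb < j' ≤ jt`. [folklore] -/
theorem midpoint_rung_mem (δ : ℝ) (k : ℤ) {jb jt j' : ℤ} (h1 : jb < j') (h2 : j' ≤ jt) :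
    (⟨δ * (k + 1 / 2), δ * j'⟩ : ℂ) ∈ segment ℝ (cellCenter δ k jb) (cellCenter δ k jt) ∧
      (⟨δ * (k + 1 / 2), δ * j'⟩ : ℂ) ∈
        openSegment ℝ (meshPoint δ (corner k j' false false)) (meshPoint δ (corner k j' true false)) := by
  constructor
  · -- parameter `θ = (j' - jb - 1/2) / (jt - jb)` along the vertical segment
    have hpos : (0 : ℝ) < jt - jb := by
      have : jb < jt := h1.trans_le h2
      exact_mod_cast sub_pos.2 this
    set θ : ℝ := ((j' : ℝ) - jb - 1 / 2) / (jt - jb) with hθ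
    have hθ0 : 0 ≤ θ := div_nonneg (by
      have : (jb : ℝ) + 1 ≤ j' := by exact_mod_cast h1
      linarith) hpos.le
    have hθ1 : θ ≤ 1 := by
      rw [div_le_one hpos]
      have : (j' : ℝ) ≤ jt := by exact_mod_cast h2
      linarith
    refine ⟨1 - θ, θ, by linarith, hθ0, by ring, ?_⟩
    apply Complex.ext
    · simp only [add_re, smul_re, cellCenter_re, smul_eq_mul]; ring
    · simp only [add_im, smul_im, cellCenter_im, smul_eq_mul]
      have hθ' : θ * ((jt : ℝ) - jb) = j' - jb - 1 / 2 := by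
        rw [hθ]; field_simp
      linear_combination δ * hθ'
  · rw [meshPoint_rung_left, meshPoint_rung_right]
    refine ⟨1 / 2, 1 / 2, by norm_num, by norm_num, by norm_num, ?_⟩
    apply Complex.ext
    · simp only [add_re, smul_re, smul_eq_mul]; ring
    · simp only [add_im, smul_im, smul_eq_mul]; ring

/-- **The spine crosses each rung of its window once, positively.** The crossing defect of the
vertical segment from the centre of cell `(k, jb)` to the centre of cell `(k, jt)` relative to
the rung `j'` of column `k`, `jb < j' ≤ jt`, is `2πi`. [folklore] -/
theorem crossInc_spine_rung (hδ : 0 < δ) (k : ℤ) {jb jt j' : ℤ} (h1 : jb < j') (h2 : j' ≤ jt) :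
    (Path.segment (cellCenter δ k jb) (cellCenter δ k jt)).crossInc
      (meshPoint δ (corner k j' false false)) (meshPoint δ (corner k j' true false)) =
      2 * Real.pi * I := by
  have him : (meshPoint δ (corner k j' false false)).im = (meshPoint δ (corner k j' true false)).im := by
    simp
  obtain ⟨hseg, hopen⟩ := midpoint_rung_mem δ k h1 h2
  refine Path.crossInc_segment_of_cross ?_ ?_ ⟨_, hseg, hopen⟩
  · rw [segSide_of_im_eq him]
    simp only [cellCenter_im, meshPoint_im, meshPoint_re, corner_one, corner_zero]
    push_cast
    have : (jb : ℝ) + 1 ≤ j' := by exact_mod_cast h1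
    nlinarith [mul_pos (mul_pos hδ hδ) (show (0 : ℝ) < j' - jb - 1 / 2 by linarith)]
  · rw [segSide_of_im_eq him]
    simp only [cellCenter_im, meshPoint_im, meshPoint_re, corner_one, corner_zero]
    push_cast
    have : (j' : ℝ) ≤ jt := by exact_mod_cast h2
    nlinarith [mul_pos (mul_pos hδ hδ) (show (0 : ℝ) < jt + 1 / 2 - j' by linarith)]

/-- Points of the vertical spine: `re z = δ(k + ½)` and `im z` between the two centre heights.
[folklore] -/
theorem re_eq_and_im_mem_of_mem_spine {k jb jt : ℤ} (hle : jb ≤ jt) (hδ : 0 ≤ δ) {z : ℂ}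
    (hz : z ∈ segment ℝ (cellCenter δ k jb) (cellCenter δ k jt)) :
    z.re = δ * (k + 1 / 2) ∧ δ * (jb + 1 / 2) ≤ z.im ∧ z.im ≤ δ * (jt + 1 / 2) := by
  obtain ⟨a, b, ha, hb, hab, rfl⟩ := hz
  simp only [add_re, smul_re, cellCenter_re, smul_eq_mul, add_im, smul_im, cellCenter_im]
  have hle' : (jb : ℝ) ≤ jt := by exact_mod_cast hle
  refine ⟨by rw [← add_mul, hab, one_mul], ?_, ?_⟩
  · have : δ * (jb + 1 / 2) = a * (δ * (jb + 1 / 2)) + b * (δ * (jb + 1 / 2)) := by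
      rw [← add_mul, hab, one_mul]
    rw [this]
    nlinarith [mul_nonneg hb hδ]
  · have : δ * (jt + 1 / 2) = a * (δ * (jt + 1 / 2)) + b * (δ * (jt + 1 / 2)) := by
      rw [← add_mul, hab, one_mul]
    rw [this]
    nlinarith [mul_nonneg ha hδ]

/-- Points of the spine are within the spine's length of its bottom centre. [folklore] -/
theorem dist_le_of_mem_spine {k jb jt : ℤ} (hle : jb ≤ jt) (hδ : 0 ≤ δ) {z : ℂ}
    (hz : z ∈ segment ℝ (cellCenter δ k jb) (cellCenter δ k jt)) :
    dist z (cellCenter δ k jb) ≤ δ * (jt - jb) := by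
  obtain ⟨hre, h1, h2⟩ := re_eq_and_im_mem_of_mem_spine hle hδ hz
  rw [Complex.dist_eq]
  refine (norm_le_abs_re_add_abs_im _).trans ?_
  rw [sub_re, sub_im, hre, cellCenter_re, cellCenter_im, sub_self, abs_zero, zero_add,
    abs_of_nonneg (by linarith)]
  linarith

/-! ### Far points have winding number zero -/

/-- **A loop inside a ball does not wind around points outside it.** If the loop `σ` lies in
`ball c R` and `R ≤ dist z c`, then `wind (σ - z) = 0`: on the ball, `w ↦ w - z` is within
`‖w - c‖ < R ≤ ‖c - z‖` of the nonvanishing constant `c - z`, so it has a continuous logarithm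
(Rouché for logarithms). [folklore] -/
theorem wind_sub_eq_zero_of_subset_ball {x c z : ℂ} {R : ℝ} (σ : Path x x)
    (hσ : range σ ⊆ ball c R) (hz : R ≤ dist z c) :
    wind (fun t => σ.extend t - z) = 0 := by
  have hcz : c - z ≠ 0 := by
    intro h
    rw [sub_eq_zero] at h
    rw [h, dist_self] at hz
    have : (range σ).Nonempty := range_nonempty _
    obtain ⟨w, hw⟩ := this
    have := hσ hw
    rw [mem_ball] at this
    linarith [dist_nonneg (x := w) (y := c)]
  have hlog : HasLogOn (fun w : ℂ => w - z) (ball c R) := by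
    refine hasLogOn_of_norm_sub_lt (g := fun _ => c - z) (continuousOn_id.sub continuousOn_const)
      (hasLogOn_const hcz _) fun w hw => ?_
    rw [show w - z - (c - z) = w - c by ring, ← dist_eq_norm, ← dist_eq_norm]
    rw [dist_comm c z]
    exact (mem_ball.1 hw).trans_le hz
  have hmaps : MapsTo σ.extend (Icc 0 1) (ball c R) := fun t ht => by
    rw [Path.extend_apply σ ht]
    exact hσ (mem_range_self _)
  have := wind_comp_eq_zero_of_hasLogOn hlog σ.continuous_extend.continuousOn hmaps (by simp)
  exact this

end

end Literature.Probability.LatticeModels.Mesh
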